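import Summits.QuantumFields.YangMills.Theorems.BalabanUVNodesK0VariationalThm1Top7Floor
import Literature.MathematicalPhysics.QuantumFieldTheory.Balaban1983to89.Node00.Record12BgRowCoClassCP

/-!
# K0⁗ ROW P11 — FILE 21C: THE FLOOR `2L² ≤ B₃` FOR node00-def-P11's C′ FACT `VariationalThm1RegSepCo7` AND FOR THE v1.5 FACT OF RECORD `VariationalThm1RegSepCoP7`
# (corollaries of part B at the top domains `T_η` and `suppDomOfRecord`)

Cell `pub-ymgap`, seat `pub-ymgap-dag-n21-c` g8 (R134 (a) N21 NE7c s1; K0⁗ ROW P11 negative side of record; INBOX INTENT-1 of 2026-08-27 ≈10:00Z).  Filed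
`--kind proof --supports stmt-QuantumFields-20289 --as helper`.  Part C of FILE 21 (A = `…K0TopClassSmallActionMinimiser`, B = `…K0VariationalThm1Top7Floor`).
[15] = [Balaban1985Variational]; [6] = [Balaban1985RegularSpaces]; [III] = [Balaban1988Convergent].

CONTENTS (theorems only).  §1 the two corollaries of part B at a general top domain (`not_variationalThm1RegSepTop7_of_lt_two_sq`, `variationalThm1RegSepTop7_degenerate_of_lt_two_sq`);
§2 ★★ `two_sq_L_le_of_variationalThm1RegSepCo7` (C′ = 12b's fact at `Sup := T_η`, 12b `VariationalThm1RegSepCo7.toTop7_univ`) + `not_…_of_lt_two_sq` + `…_degenerate_of_lt_two_sq`;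
§3 ★★ `two_sq_L_le_of_variationalThm1RegSepCoP7` (v1.5 = 12b's fact at `Sup := suppDomOfRecord`, 12c `VariationalThm1RegSepCoP7.toTop7`) + `not_…_of_lt_two_sq` + `…_degenerate_of_lt_two_sq`.
WHAT IT MEANS (numbers, K0 lane): node00-def-K0a's closers `exists_k0SepCo_of_thm1RegSepCo7 …` (v1.4) and their CoP images (16b∕16c, v1.5) take `h15` under the sign `0 ≤ B₃`;
with `0 < a₀`, `0 < a₁` the antecedent is met only with `2L² ≤ B₃` (`L ≥ 13` ⇒ `B₃ ≥ 338`) — FILE 11∕12c's displayed floor is a theorem for the editions rev 20 keys on.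
HONEST FRAMING: kernel certificate about TREE-typed facts; nothing of Bałaban asserted or refuted (print: `B₃ = B₃(d, L)`); K0⁗ neither discharged nor refuted; N21 NOT
discharged; counts unmoved; no `def`, no `sorry`, no `instance`.
DEPENDENCES (by name): part B `two_sq_L_le_of_variationalThm1RegSepTop7`; node00-def-P11 12b `VariationalThm1RegSepCo7.toTop7_univ`, 12c `VariationalThm1RegSepCoP7.toTop7`.
-/

noncomputable section

namespace Summit.QuantumFields.YangMills.Theorems.K0VariationalThm1Top7Floor

open Literature.MathematicalPhysics.QuantumFieldTheory.Balaban1983to89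
open Literature.MathematicalPhysics.QuantumFieldTheory.Balaban1983to89.Node00
open Literature.MathematicalPhysics.QuantumFieldTheory.Balaban1983to89.T4Continuum

/-! ## §1  Corollaries of part B at a general top domain -/
section CorTop

variable {F : T4Family} {N : ℕ} [NeZero N]

/-- Hence `¬ VariationalThm1RegSepTop7 F N Sup B₃ a₀ a₁` for every `B₃ < 2L²`, every top domain (`N ≥ 2`, `0 < a₀`, `0 < a₁`). [cite: Balaban1985Variational, Thm 1 (7)–(8) pp.278–279 (bookkeeping)] -/
theorem not_variationalThm1RegSepTop7_of_lt_two_sq (Sup : (ν : Stage7Numerics) → (K : ℕ) → (ℕ → Set (Site (F.P K) 0)) → Set (Site (F.P K) 0))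
    (hN : 2 ≤ N) {B₃ a₀ a₁ : ℝ} (ha₀ : 0 < a₀) (ha₁ : 0 < a₁) (hB : B₃ < 2 * (F.L : ℝ) ^ 2) :
    ¬ VariationalThm1RegSepTop7 F N Sup B₃ a₀ a₁ :=
  fun h => absurd (two_sq_L_le_of_variationalThm1RegSepTop7 Sup hN ha₀ ha₁ h) (not_le.mpr hB)

/-- Truth set of 12b's fact below the floor, every top domain: for `B₃ < 2L²` it holds only in the degenerate corner `a₀ ≤ 0 ∨ a₁ ≤ 0`. [cite: Balaban1985Variational, Thm 1 (7)–(8) pp.278–279 (bookkeeping)] -/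
theorem variationalThm1RegSepTop7_degenerate_of_lt_two_sq (Sup : (ν : Stage7Numerics) → (K : ℕ) → (ℕ → Set (Site (F.P K) 0)) → Set (Site (F.P K) 0))
    (hN : 2 ≤ N) {B₃ a₀ a₁ : ℝ} (hB : B₃ < 2 * (F.L : ℝ) ^ 2) (h : VariationalThm1RegSepTop7 F N Sup B₃ a₀ a₁) : a₀ ≤ 0 ∨ a₁ ≤ 0 := by
  by_contra hne
  push Not at hne
  exact not_variationalThm1RegSepTop7_of_lt_two_sq Sup hN hne.1 hne.2 hB h

end CorTop

/-! ## §2  ★★ THE FLOOR FOR THE C′ FACT: `VariationalThm1RegSepCo7 F N B₃ a₀ a₁ → 2L² ≤ B₃` -/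
section FloorCo7

variable {F : T4Family} {N : ℕ} [NeZero N]

/-- **★★ THE FLOOR OF RECORD FOR node00-def-P11's C′ FACT: `VariationalThm1RegSepCo7 F N B₃ a₀ a₁ → 2L² ≤ B₃`** (every `N ≥ 2`, `0 < a₀`, `0 < a₁`), UNCONDITIONALLY — C′ IS
12b's fact at the top domain `T_η` (12b `VariationalThm1RegSepCo7.toTop7_univ`), and §1 holds at every top domain.  So the sign `0 ≤ B₃` under which node00-def-K0a's closers
`exists_k0SepCo_of_thm1RegSepCo7 …` take `h15 : VariationalThm1RegSepCo7 …` is met only with `2L² ≤ B₃` once `0 < a₀`, `0 < a₁`: FILE 11's displayed floor is a theorem.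
[cite: Balaban1985Variational, (2),(6) p.278, Thm 1 (7)–(8) pp.278–279; Balaban1985RegularSpaces, (1.7)–(1.9) p.77; Balaban1988Convergent, (2.6)–(2.8) pp.255–256, (2.12) p.256 (bookkeeping)] -/
theorem two_sq_L_le_of_variationalThm1RegSepCo7 (hN : 2 ≤ N) {B₃ a₀ a₁ : ℝ} (ha₀ : 0 < a₀) (ha₁ : 0 < a₁)
    (h : VariationalThm1RegSepCo7 F N B₃ a₀ a₁) : 2 * (F.L : ℝ) ^ 2 ≤ B₃ :=
  two_sq_L_le_of_variationalThm1RegSepTop7 _ hN ha₀ ha₁ h.toTop7_univ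

/-- Hence `¬ VariationalThm1RegSepCo7 F N B₃ a₀ a₁` for every `B₃ < 2L²` (`N ≥ 2`, `0 < a₀`, `0 < a₁`). [cite: Balaban1985Variational, Thm 1 (7)–(8) pp.278–279 (bookkeeping)] -/
theorem not_variationalThm1RegSepCo7_of_lt_two_sq (hN : 2 ≤ N) {B₃ a₀ a₁ : ℝ} (ha₀ : 0 < a₀) (ha₁ : 0 < a₁) (hB : B₃ < 2 * (F.L : ℝ) ^ 2) :
    ¬ VariationalThm1RegSepCo7 F N B₃ a₀ a₁ :=
  fun h => absurd (two_sq_L_le_of_variationalThm1RegSepCo7 hN ha₀ ha₁ h) (not_le.mpr hB)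

/-- Truth set of the C′ fact below the floor: for `B₃ < 2L²` it holds only in the degenerate corner `a₀ ≤ 0 ∨ a₁ ≤ 0`. [cite: Balaban1985Variational, Thm 1 (7)–(8) pp.278–279 (bookkeeping)] -/
theorem variationalThm1RegSepCo7_degenerate_of_lt_two_sq (hN : 2 ≤ N) {B₃ a₀ a₁ : ℝ} (hB : B₃ < 2 * (F.L : ℝ) ^ 2)
    (h : VariationalThm1RegSepCo7 F N B₃ a₀ a₁) : a₀ ≤ 0 ∨ a₁ ≤ 0 := by
  by_contra hne
  push Not at hne
  exact not_variationalThm1RegSepCo7_of_lt_two_sq hN hne.1 hne.2 hB h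

end FloorCo7

/-! ## §3  ★★ THE FLOOR FOR THE v1.5 FACT OF RECORD: `VariationalThm1RegSepCoP7 F N B₃ a₀ a₁ → 2L² ≤ B₃` -/
section FloorCoP7

variable {F : T4Family} {N : ℕ} [NeZero N]

/-- **★★ THE FLOOR OF RECORD FOR THE v1.5 FACT `VariationalThm1RegSepCoP7 F N B₃ a₀ a₁ → 2L² ≤ B₃`** (every `N ≥ 2`, `0 < a₀`, `0 < a₁`), UNCONDITIONALLY — 12c's fact IS 12b's
fact at the top domain `suppDomOfRecord` (`VariationalThm1RegSepCoP7.toTop7`, definitional), and part B holds at every top domain: the re-range of the scale-0 class to print's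
collar ([III] p.256–257, FINDING №7 F7-b) does not touch the corner plaquette meeting `Ω₁` from outside, which (8)₁ still ranges over.
[cite: Balaban1985Variational, (2),(6) p.278, Thm 1 (7)–(8) pp.278–279; Balaban1985RegularSpaces, (1.7)–(1.9) p.77; Balaban1988Convergent, (2.12)–(2.13) pp.256–257 (bookkeeping)] -/
theorem two_sq_L_le_of_variationalThm1RegSepCoP7 (hN : 2 ≤ N) {B₃ a₀ a₁ : ℝ} (ha₀ : 0 < a₀) (ha₁ : 0 < a₁)
    (h : VariationalThm1RegSepCoP7 F N B₃ a₀ a₁) : 2 * (F.L : ℝ) ^ 2 ≤ B₃ :=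
  two_sq_L_le_of_variationalThm1RegSepTop7 _ hN ha₀ ha₁ h.toTop7

/-- Hence `¬ VariationalThm1RegSepCoP7 F N B₃ a₀ a₁` for every `B₃ < 2L²` (`N ≥ 2`, `0 < a₀`, `0 < a₁`). [cite: Balaban1985Variational, Thm 1 (7)–(8) pp.278–279 (bookkeeping)] -/
theorem not_variationalThm1RegSepCoP7_of_lt_two_sq (hN : 2 ≤ N) {B₃ a₀ a₁ : ℝ} (ha₀ : 0 < a₀) (ha₁ : 0 < a₁) (hB : B₃ < 2 * (F.L : ℝ) ^ 2) :
    ¬ VariationalThm1RegSepCoP7 F N B₃ a₀ a₁ :=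
  fun h => absurd (two_sq_L_le_of_variationalThm1RegSepCoP7 hN ha₀ ha₁ h) (not_le.mpr hB)

/-- Truth set of the v1.5 fact below the floor: for `B₃ < 2L²` it holds only in the degenerate corner `a₀ ≤ 0 ∨ a₁ ≤ 0`. [cite: Balaban1985Variational, Thm 1 (7)–(8) pp.278–279 (bookkeeping)] -/
theorem variationalThm1RegSepCoP7_degenerate_of_lt_two_sq (hN : 2 ≤ N) {B₃ a₀ a₁ : ℝ} (hB : B₃ < 2 * (F.L : ℝ) ^ 2)
    (h : VariationalThm1RegSepCoP7 F N B₃ a₀ a₁) : a₀ ≤ 0 ∨ a₁ ≤ 0 := by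
  by_contra hne
  push Not at hne
  exact not_variationalThm1RegSepCoP7_of_lt_two_sq hN hne.1 hne.2 hB h

end FloorCoP7

end Summit.QuantumFields.YangMills.Theorems.K0VariationalThm1Top7Floor

end
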